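import Literature.Topology.FourManifolds.KhTriangle
import Literature.Topology.FourManifolds.KhLoopSquare
import HarnessLib

/-!
# The triangle of the third Reidemeister move is a loop square, on both sides of the move

Sibling file of `KhComplex.lean` (third step towards the invariance of Khovanov homology under
`PolyakMove.omega3a`): inside the layer `z = 1` of the cube of resolutions, the chords `x`
(flipped first) and `y` (flipped second) and the three sides of the triangle form a loop square
(`GaussDiagram.LoopSq`, `KhLoopSquare.lean`) of `G` (`triLoopSq`) and of its braid rearrangement
`G.braidMove x y z` (`triLoopSq'`), by the results of `KhTriangle.lean`. Hence all of
`KhLoopSquare.lean` — the five sectors `A ⊕ P ⊕ Q ⊕ U ⊕ R` of the enhanced states and the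
identity blocks `A → P`, `Q → U` of the differential — applies to both sides of the third move.
Khovanov (2000), §5.4; Bar-Natan (2002), §4.4.

No named fact is introduced.

## References

* M. Khovanov, *A categorification of the Jones polynomial*, Duke Math. J. 101 (2000) 359–426,
  §5.4. [cite: Khovanov2000, §5.4]
* D. Bar-Natan, *On Khovanov's categorification of the Jones polynomial*, Algebr. Geom. Topol. 2
  (2002) 337–370, §4.4. [cite: BarNatan2002, §4]
-/

open Function

noncomputable section

namespace Literature.Topology.FourManifolds

namespace GaussDiagram

variable (G : GaussDiagram) {x y z : Fin G.n} (hxz : x ≠ z)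
  (ha : (G.overPos y : ℕ) = G.overPos x + 1) (hb : (G.overPos z : ℕ) = G.underPos x + 1)
  (hc : (G.underPos z : ℕ) = G.underPos y + 1)
  (hx : G.sign x = 1) (hy : G.sign y = 1) (hz : G.sign z = 1)

/-- Membership in the triangle is decidable. [folklore] -/
instance instDecidablePredInT (x y : Fin G.n) : DecidablePred (G.InT x y) := fun _ ↦ by
  unfold InT; infer_instance

/-- **The triangle of `Ω3a` is a loop square of `G`** inside the layer `z = 1`: `f = x`, `g = y`,
the small circle is the triangle. Khovanov (2000), §5.4; Bar-Natan (2002), §4.4. [cite: Khovanov2000, §5.4] -/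
def triLoopSq : G.LoopSq where
  f := x
  g := y
  P := fun σ ↦ σ z = true
  InO := G.InT x y
  f_ne_g := G.x_ne_y ha
  P_update_f := fun σ b ↦ by
    rw [show Function.update σ x b z = σ z from Function.update_of_ne (fun h ↦ hxz h.symm) _ _]
  P_update_g := fun σ b ↦ by
    rw [show Function.update σ y b z = σ z from Function.update_of_ne (fun h ↦ G.y_ne_z hc h.symm) _ _]
  closure := fun σ hxT hyT hzT u v hu h ↦
    (G.circleOf_eq_sideA_iff hxz ha hb hc hx hy hz hxT hyT hzT v).1
      (h.trans ((G.circleOf_eq_sideA_iff hxz ha hb hc hx hy hz hxT hyT hzT u).2 hu))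
  connected := fun σ hxT hyT hzT u v hu hv ↦
    ((G.circleOf_eq_sideA_iff hxz ha hb hc hx hy hz hxT hyT hzT v).2 hv).trans
      ((G.circleOf_eq_sideA_iff hxz ha hb hc hx hy hz hxT hyT hzT u).2 hu).symm
  split := fun σ hf hg hP ↦ G.isSplitAt_x hxz ha hb hc hx hy hz hf hg hP
  merge := fun σ hf hg hP ↦ G.isMergeAt_y hxz ha hb hc hx hy hz hf hg hP
  inO_aF_bF := Or.inl ⟨G.not_inT_inA hxz ha hb hc, G.inT_sideA⟩
  inO_aG_bG := Or.inr ⟨by rw [G.arcIn_overPos_y ha]; exact G.inT_sideA, G.not_inT_outA ha⟩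
  not_inO_arcIn := fun σ j hP _ hj _ hjy ↦ by
    rw [G.inT_arcIn_iff ha hb hc]
    rintro (h | h | h)
    · exact hjy (G.overPos_injective h)
    · have := G.overPos_injective h
      subst this
      rw [hP] at hj
      exact Bool.noConfusion hj
    · exact G.overPos_ne_underPos j z h

/-- **The triangle of `Ω3a` is a loop square of the braid rearrangement** inside the layer
`z = 1`, with the same `f = x`, `g = y` and the same small circle. [cite: Khovanov2000, §5.4] -/
def triLoopSq' : (G.braidMove x y z).LoopSq where
  f := x
  g := y
  P := fun σ ↦ σ z = true
  InO := G.InT x y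
  f_ne_g := G.x_ne_y ha
  P_update_f := fun σ b ↦ by
    rw [show Function.update σ x b z = σ z from Function.update_of_ne (fun h ↦ hxz h.symm) _ _]
  P_update_g := fun σ b ↦ by
    rw [show Function.update σ y b z = σ z from Function.update_of_ne (fun h ↦ G.y_ne_z hc h.symm) _ _]
  closure := fun σ hxT hyT hzT u v hu h ↦
    (G.circleOf_braidMove_eq_sideA_iff hxz ha hb hc hx hy hz hxT hyT hzT v).1
      (h.trans ((G.circleOf_braidMove_eq_sideA_iff hxz ha hb hc hx hy hz hxT hyT hzT u).2 hu))
  connected := fun σ hxT hyT hzT u v hu hv ↦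
    ((G.circleOf_braidMove_eq_sideA_iff hxz ha hb hc hx hy hz hxT hyT hzT v).2 hv).trans
      ((G.circleOf_braidMove_eq_sideA_iff hxz ha hb hc hx hy hz hxT hyT hzT u).2 hu).symm
  split := fun σ hf hg hP ↦ G.isSplitAt_x_braidMove hxz ha hb hc hx hy hz hf hg hP
  merge := fun σ hf hg hP ↦ G.isMergeAt_y_braidMove hxz ha hb hc hx hy hz hf hg hP
  inO_aF_bF := Or.inr ⟨by rw [G.overPos_braidMove_x hxz, arcIn_braidMove, G.arcIn_overPos_y ha]
                          exact G.inT_sideA,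
    by rw [G.overPos_braidMove_x hxz]; exact G.not_inT_outA ha⟩
  inO_aG_bG := Or.inl ⟨by rw [G.overPos_braidMove_y (G.y_ne_z hc)]; exact G.not_inT_inA hxz ha hb hc,
    by rw [G.overPos_braidMove_y (G.y_ne_z hc)]; exact G.inT_sideA⟩
  not_inO_arcIn := fun σ j hP _ hj hjx hjy ↦ by
    by_cases hjz : j = z
    · rw [hjz, hP] at hj
      exact fun _ ↦ Bool.noConfusion hj
    · rw [G.overPos_braidMove_of_ne hjx hjy hjz, arcIn_braidMove, G.inT_arcIn_iff ha hb hc]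
      rintro (h | h | h)
      · exact hjy (G.overPos_injective h)
      · exact hjz (G.overPos_injective h)
      · exact G.overPos_ne_underPos j z h

/-- The data of `triLoopSq`. [folklore] -/
@[simp] theorem triLoopSq_f : (G.triLoopSq hxz ha hb hc hx hy hz).f = x := rfl
/-- The data of `triLoopSq`. [folklore] -/
@[simp] theorem triLoopSq_g : (G.triLoopSq hxz ha hb hc hx hy hz).g = y := rfl
/-- The data of `triLoopSq`. [folklore] -/
theorem triLoopSq_P (σ : G.State) : (G.triLoopSq hxz ha hb hc hx hy hz).P σ ↔ σ z = true := Iff.rfl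
/-- The data of `triLoopSq`. [folklore] -/
theorem triLoopSq_InO (u : G.Arc) : (G.triLoopSq hxz ha hb hc hx hy hz).InO u ↔ G.InT x y u := Iff.rfl
/-- The data of `triLoopSq'`. [folklore] -/
@[simp] theorem triLoopSq'_f : (G.triLoopSq' hxz ha hb hc hx hy hz).f = x := rfl
/-- The data of `triLoopSq'`. [folklore] -/
@[simp] theorem triLoopSq'_g : (G.triLoopSq' hxz ha hb hc hx hy hz).g = y := rfl
/-- The data of `triLoopSq'`. [folklore] -/
theorem triLoopSq'_P (σ : G.State) : (G.triLoopSq' hxz ha hb hc hx hy hz).P σ ↔ σ z = true := Iff.rfl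
/-- The data of `triLoopSq'`. [folklore] -/
theorem triLoopSq'_InO (u : G.Arc) : (G.triLoopSq' hxz ha hb hc hx hy hz).InO u ↔ G.InT x y u := Iff.rfl

end GaussDiagram

end Literature.Topology.FourManifolds
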